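import Summits.BirchSwinnertonDyer.BirchSwinnertonDyer.Theorems.AlignedTransportAtTwoMainConjectureOfRankZeroBSDAtTwoFineRoadKleinCountingLambdaSplit
import HarnessLib

/-!
# Route `AlignedTransportAtTwo`, crux C2 `MainConjectureOfRankZeroBSDAtTwo` (stmt-BirchSwinnertonDyer-22298),
# road (b″): PERFECT DESCENT at `2`, part XII — the STEINBERG (Morita) splitting of the norm-minus part:
# `(1 − e₁)X ≅ Y ⊕ Y` with `Y = ((1 − e₁)X)^τ`, hence `μ((1 − e₁)X) = 2·μ(Y)` and `μ(X) = μ(e₁X) + 2·μ(Y)`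

Cell `bsd-f1-sign2`, WIDTH-5 attach seat `bsd-line-att-p3` (gen 5) on line `birth` of crux C2
(`--supports` stmt-BirchSwinnertonDyer-22298; closes nothing). HONEST FRAMING: THEOREMS ONLY — no definition, no
named fact, no instance, no `sorry`; BSD is NOT proved by any of this. Sequel of parts X–XI. It kernelises the lead's
STRUCTURE REMARK (CENSUS-lead-g5.md §1 (A3), written «prose, not kernel»): with `e_χ = (2 − σ − σ²)/3` central,
`e_χℤ₂[S₃] = ℤ₂[ζ₃]⟨τ⟩ ≅ M₂(ℤ₂)`, so every `Λ[S₃]`-module with `3` invertible is `X ≅ X^{C₃} ⊕ Y^{⊕2}` with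
`(Y^{⊕2})^τ ≅ Y`; for `X = X(ℚ(W[2])_∞)`: «`μ₂(ℚ(W[2])) = 2·μ(Y) (+ μ(ℚ(√Δ_W)) = 0, Ferrero–Washington)`» — the open content of
every road of the crux is the ONE invariant `μ(Y)`.

Setting: a commutative ring `R` with `3 ∈ Rˣ` (e.g. `Λ = ℤ₂⟦T⟧`, part XI `isUnit_three_iwasawaAlgebra_two`), an `R`-module `X`
with an `R`-linear action of a group `Q`, and `σ, τ ∈ Q` acting on `X` with `σ³ = 1`, `τ² = 1`, `τσ = σ²τ` (for `Q` acting on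
the Klein four-group `V₄` through `Aut(V₄) ≅ S₃` with kernel acting trivially on `X` these are parts VI/VII:
`smul_smul_smul_eq_self_of_kernel`, `tau_tau_V`, `tau_sigma_V`). Write `N = 1 + σ + σ²`, `W = ker N` (`= (1 − e₁)X`), `X^τ =
ker(τ − 1)`, `Y = W ⊓ X^τ`.

## What is proved

* §1 `norm_smul_sigma` / `norm_smul_tau` (`Nσ = σN = N`, `Nτ = τN`: `W` is `σ`- and `τ`-stable); on `W`: `σ² = −1 − σ`, and for
  `δ = σ − σ²`: `δ² = −3` (`delta_delta_eq_neg_three_smul`), `τδ = −δτ`.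
* §2 **`nonempty_prod_fixed_linearEquiv_ker_norm`**: `(Y × Y) ≃ₗ[R] W` via `(a, b) ↦ a + σb` (inverse `b = δ⁻¹(z − τz)`,
  `a = z − σb`; `δ⁻¹ = −3⁻¹δ`) — the Morita splitting `W = Y ⊕ σY`, `Y = W^τ`.
* §3 (`R = Λ = ℤ₂⟦T⟧`) **`lengthAt_ker_norm_eq_two_mul`**: `ℓ_𝔭(W) = 2·ℓ_𝔭(Y)` at every prime `𝔭`;
  **`lengthAt_eq_lengthAt_range_norm_add_two_mul`**: `ℓ_𝔭(X) = ℓ_𝔭(NX) + 2·ℓ_𝔭(Y)` («`μ₂(F) = μ(e₁-part) + 2μ(Y)`»);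
  **`finite_equivariant_iff_fixed_isTorsion_and_muInvariant_eq_zero_S3`**: `Hom_Q(X, V₄)` finite ⟺ `Y` is `Λ`-torsion with
  `μ(Y) = 0` — NO norm-part / Ferrero–Washington input: the open content is the single invariant `μ(Y)`.

Not here (typing / number theory): `Y` versus the Iwasawa module of the cubic field `ℚ(W[2])^τ = ℚ(e₁)` (the quadratic
descent `F/F^τ` has degree `2 = p`: genus theory, [Iw73] — att-p5 g3 NARROW-A2), and every CFT identification.

References: J.-P. Serre, *Linear Representations of Finite Groups*, §2.6; I. Reiner, *Maximal Orders*, §40 (crossed products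
over unramified extensions split); CENSUS-lead-g5.md §1 (A3) (lead att-p2 g5).
-/

set_option autoImplicit false
-- the Theorems namespace of this sub repeats the summit name by design (D-0017 nested layout)
set_option linter.dupNamespace false

noncomputable section

namespace Summit.BirchSwinnertonDyer.BirchSwinnertonDyer.Theorems.AlignedTransportAtTwoFineRoad.PerfectDescent

open Literature.NumberTheory.EllipticCurves Literature.NumberTheory.EllipticCurves.IwasawaAlgebra
  Literature.NumberTheory.EllipticCurves.Module

/-! ## §1 Stability of `W = ker(1 + σ + σ²)` and the element `δ = σ − σ²` with `δ² = −3` on `W` -/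

section Relations

variable {Q : Type*} [Group Q] {R : Type*} [CommRing R]
  {X : Type*} [AddCommGroup X] [_root_.Module R X] [DistribMulAction Q X] [SMulCommClass Q R X]

/-- `W = ker(1 + σ + σ²)` is `σ`-stable: `N(σx) = σ(Nx)` (`σ³ = 1`). [folklore] -/
theorem norm_smul_sigma {σ : Q} (hσ3 : ∀ x : X, σ • (σ • (σ • x)) = x) (x : X) :
    (σ • x) + σ • (σ • x) + σ • (σ • (σ • x)) = σ • (x + σ • x + σ • (σ • x)) := by
  rw [smul_add, smul_add, hσ3]

/-- `W = ker(1 + σ + σ²)` is `τ`-stable: `N(τx) = τ(Nx)` (`τσ = σ²τ`, `τσ² = στ`). [folklore] -/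
theorem norm_smul_tau {σ τ : Q} (hσ3 : ∀ x : X, σ • (σ • (σ • x)) = x)
    (hτσ : ∀ x : X, τ • (σ • x) = σ • (σ • (τ • x))) (x : X) :
    (τ • x) + σ • (τ • x) + σ • (σ • (τ • x)) = τ • (x + σ • x + σ • (σ • x)) := by
  have hτσσ : τ • (σ • (σ • x)) = σ • (τ • x) := by rw [hτσ, hτσ, hσ3]
  rw [smul_add, smul_add, hτσ, hτσσ]
  abel

/-- On `W`: `σ²w = −w − σw`. [folklore] -/
theorem sigma_sigma_eq_of_mem_ker_norm {σ : Q} {w : X} (hw : w + σ • w + σ • (σ • w) = 0) :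
    σ • (σ • w) = -w - σ • w := by
  rw [eq_sub_iff_add_eq, eq_neg_iff_add_eq_zero, ← hw]; abel

omit [SMulCommClass Q R X] in
/-- **`δ² = −3` on `W`** for `δ = σ − σ²`: `(σ − σ²)²w = (σ² − 2σ³ + σ⁴)w = σ²w − 2w + σw = −3w`. [folklore] -/
theorem delta_delta_eq_neg_three_smul {σ : Q} (hσ3 : ∀ x : X, σ • (σ • (σ • x)) = x) {w : X}
    (hw : w + σ • w + σ • (σ • w) = 0) :
    (σ • (σ • w - σ • (σ • w)) - σ • (σ • (σ • w - σ • (σ • w)))) = -((3 : R) • w) := by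
  have hσσ := sigma_sigma_eq_of_mem_ker_norm hw
  have e3 : (3 : R) • w = w + w + w := by
    rw [show (3 : R) = 1 + 1 + 1 by norm_num, add_smul, add_smul, one_smul]
  simp only [smul_sub, hσ3]
  rw [hσσ, e3]
  abel

end Relations

/-! ## §2 The Steinberg splitting `W ≅ Y × Y`, `Y = W ∩ X^τ` -/

section Steinberg

variable {Q : Type*} [Group Q] {R : Type*} [CommRing R]
  {X : Type*} [AddCommGroup X] [_root_.Module R X] [DistribMulAction Q X] [SMulCommClass Q R X]

/-- **The Steinberg (Morita) splitting of the norm-minus part.** Let `R` be a commutative ring with `3 ∈ Rˣ`, `X` an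
`R`-module with an `R`-linear `Q`-action, and `σ, τ ∈ Q` with `σ³ = 1`, `τ² = 1`, `τσ = σ²τ` on `X` (an `S₃` through which the
action on `W` factors). Put `N = 1 + σ + σ²`, `W = ker N`, `Y = W ⊓ ker(τ − 1)`. Then `(a, b) ↦ a + σb` is an `R`-linear
ISOMORPHISM `Y × Y ≅ W`: injective since `a + σb = 0 = a + σ²b` forces `δb = 0`, `δ² = −3 ∈ Rˣ`; surjective with
`b = δ⁻¹(z − τz) = −3⁻¹δ(z − τz)`, `a = z − σb`. (Over `ℤ₂`: `e_χℤ₂[S₃] ≅ M₂(ℤ₂)` and `W` is a module over it; `Y` is the image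
of a rank-one idempotent up to the unit `δ`.) [cite: SerreGaloisCohomology1997, I §5.1] -/
theorem nonempty_prod_fixed_linearEquiv_ker_norm (h3 : IsUnit (3 : R)) {σ τ : Q}
    (hσ3 : ∀ x : X, σ • (σ • (σ • x)) = x) (hττ : ∀ x : X, τ • (τ • x) = x)
    (hτσ : ∀ x : X, τ • (σ • x) = σ • (σ • (τ • x))) :
    Nonempty
      ((↥(LinearMap.ker (LinearMap.id + DistribSMul.toLinearMap R X σ + (DistribSMul.toLinearMap R X σ).comp
            (DistribSMul.toLinearMap R X σ)) ⊓ LinearMap.ker (DistribSMul.toLinearMap R X τ - LinearMap.id)) ×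
        ↥(LinearMap.ker (LinearMap.id + DistribSMul.toLinearMap R X σ + (DistribSMul.toLinearMap R X σ).comp
            (DistribSMul.toLinearMap R X σ)) ⊓ LinearMap.ker (DistribSMul.toLinearMap R X τ - LinearMap.id))) ≃ₗ[R]
        ↥(LinearMap.ker (LinearMap.id + DistribSMul.toLinearMap R X σ + (DistribSMul.toLinearMap R X σ).comp
            (DistribSMul.toLinearMap R X σ)))) := by
  obtain ⟨u, hu⟩ := h3.exists_left_inv
  set W := LinearMap.ker (LinearMap.id + DistribSMul.toLinearMap R X σ + (DistribSMul.toLinearMap R X σ).comp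
    (DistribSMul.toLinearMap R X σ)) with hWdef
  set T := LinearMap.ker (DistribSMul.toLinearMap R X τ - LinearMap.id) with hTdef
  have hW : ∀ x : X, x ∈ W ↔ x + σ • x + σ • (σ • x) = 0 := fun x ↦ by
    simp [W, LinearMap.mem_ker]
  have hT : ∀ x : X, x ∈ T ↔ τ • x = x := fun x ↦ by
    simp [T, LinearMap.mem_ker, sub_eq_zero]
  have hY : ∀ x : X, x ∈ W ⊓ T ↔ x + σ • x + σ • (σ • x) = 0 ∧ τ • x = x := fun x ↦ by
    rw [Submodule.mem_inf, hW, hT]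
  have hτσσ : ∀ x : X, τ • (σ • (σ • x)) = σ • (τ • x) := fun x ↦ by rw [hτσ, hτσ, hσ3]
  -- stability
  have hWσ : ∀ x : X, x ∈ W → σ • x ∈ W := fun x hx ↦ by
    rw [hW] at hx ⊢; rw [norm_smul_sigma hσ3, hx, smul_zero]
  have hWτ : ∀ x : X, x ∈ W → τ • x ∈ W := fun x hx ↦ by
    rw [hW] at hx ⊢; rw [norm_smul_tau hσ3 hτσ, hx, smul_zero]
  -- the map `(a, b) ↦ a + σ b`
  let Φ₀ : (↥(W ⊓ T) × ↥(W ⊓ T)) →ₗ[R] X :=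
    ((W ⊓ T).subtype).coprod ((DistribSMul.toLinearMap R X σ).comp (W ⊓ T).subtype)
  have hΦ₀ : ∀ ab : ↥(W ⊓ T) × ↥(W ⊓ T), Φ₀ ab = (ab.1 : X) + σ • (ab.2 : X) := fun ab ↦ by
    simp [Φ₀, LinearMap.coprod_apply]
  have hΦ₀W : ∀ ab, Φ₀ ab ∈ W := fun ab ↦ by
    rw [hΦ₀]
    exact W.add_mem (Submodule.mem_inf.mp ab.1.2).1 (hWσ _ (Submodule.mem_inf.mp ab.2.2).1)
  let Φ : (↥(W ⊓ T) × ↥(W ⊓ T)) →ₗ[R] W := Φ₀.codRestrict W hΦ₀W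
  have hΦ : ∀ ab, ((Φ ab : W) : X) = (ab.1 : X) + σ • (ab.2 : X) := fun ab ↦ hΦ₀ ab
  refine ⟨LinearEquiv.ofBijective Φ ⟨?_, ?_⟩⟩
  · -- injective: `a + σb = 0` and `τ`: `a + σ²b = 0`, so `δ b = 0`, `-3b = δ²b = 0`, `b = 0`
    rw [injective_iff_map_eq_zero]
    rintro ⟨a, b⟩ hab
    have h0 : (a : X) + σ • (b : X) = 0 := by
      have h := congrArg Subtype.val hab
      rw [hΦ] at h
      exact h
    obtain ⟨-, haT⟩ := (hY a).mp a.2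
    obtain ⟨hbW, hbT⟩ := (hY b).mp b.2
    have h1 : (a : X) + σ • (σ • (b : X)) = 0 := by
      have h := congrArg (fun x ↦ τ • x) h0
      simp only [smul_add, smul_zero, haT, hτσ, hbT] at h
      exact h
    have hδ : σ • (b : X) - σ • (σ • (b : X)) = 0 := by
      have h := sub_eq_zero.mpr (h0.trans h1.symm)
      rwa [add_sub_add_left_eq_sub] at h
    have h3b : (3 : R) • (b : X) = 0 := by
      have h := delta_delta_eq_neg_three_smul (R := R) hσ3 hbW
      rw [hδ, smul_zero, smul_zero, sub_zero] at h
      exact neg_eq_zero.mp h.symm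
    have hb : (b : X) = 0 := by
      have h := congrArg (fun x ↦ u • x) h3b
      simp only [smul_smul, hu, one_smul, smul_zero] at h
      exact h
    have ha : (a : X) = 0 := by rw [hb, smul_zero, add_zero] at h0; exact h0
    exact Prod.ext (Subtype.ext ha) (Subtype.ext hb)
  · -- surjective: `b = -u δ (z - τ z)`, `a = z - σ b`
    rintro ⟨z, hz⟩
    -- `y = z - τz`, `τ y = -y`
    have hyW : z - τ • z ∈ W := W.sub_mem hz (hWτ z hz)
    have hyW' := (hW _).mp hyW
    have hτy : τ • (z - τ • z) = -(z - τ • z) := by rw [smul_sub, hττ]; abel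
    -- `d = δ y`: in `W`, `τ`-fixed, `δ d = -3 y`
    have hdW : σ • (z - τ • z) - σ • (σ • (z - τ • z)) ∈ W :=
      W.sub_mem (hWσ _ hyW) (hWσ _ (hWσ _ hyW))
    have hτd : τ • (σ • (z - τ • z) - σ • (σ • (z - τ • z))) =
        σ • (z - τ • z) - σ • (σ • (z - τ • z)) := by
      rw [smul_sub, hτσ, hτσσ, hτy]
      simp only [smul_neg]
      abel
    have hδd := delta_delta_eq_neg_three_smul (R := R) hσ3 hyW'
    -- `b = -u d`
    have hbW : -(u • (σ • (z - τ • z) - σ • (σ • (z - τ • z)))) ∈ W := W.neg_mem (W.smul_mem u hdW)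
    have hbT : τ • (-(u • (σ • (z - τ • z) - σ • (σ • (z - τ • z))))) =
        -(u • (σ • (z - τ • z) - σ • (σ • (z - τ • z)))) := by
      rw [smul_neg, smul_comm τ u, hτd]
    -- `δ b = y`
    have hδb : σ • (-(u • (σ • (z - τ • z) - σ • (σ • (z - τ • z))))) -
        σ • (σ • (-(u • (σ • (z - τ • z) - σ • (σ • (z - τ • z)))))) = z - τ • z := by
      have e1 : σ • (-(u • (σ • (z - τ • z) - σ • (σ • (z - τ • z))))) -
          σ • (σ • (-(u • (σ • (z - τ • z) - σ • (σ • (z - τ • z)))))) =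
          -(u • (σ • (σ • (z - τ • z) - σ • (σ • (z - τ • z))) -
            σ • (σ • (σ • (z - τ • z) - σ • (σ • (z - τ • z)))))) := by
        simp only [smul_neg, smul_sub, smul_comm σ u]
        abel
      rw [e1, hδd, smul_neg, neg_neg, smul_smul, hu, one_smul]
    set b : X := -(u • (σ • (z - τ • z) - σ • (σ • (z - τ • z)))) with hb
    have hbW' := (hW b).mp hbW
    -- `a = z - σ b` is `τ`-fixed: `τ a = τ z - σ² b = τ z - (σ b - y) = z - σ b`
    have hσσb : σ • (σ • b) = σ • b - (z - τ • z) := by rw [← hδb]; abel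
    have haT : τ • (z - σ • b) = z - σ • b := by
      rw [smul_sub, hτσ, hbT, hσσb]
      abel
    have haW : z - σ • b ∈ W := W.sub_mem hz (hWσ b hbW)
    refine ⟨(⟨⟨z - σ • b, (hY _).mpr ⟨(hW _).mp haW, haT⟩⟩, ⟨b, (hY b).mpr ⟨hbW', hbT⟩⟩⟩), Subtype.ext ?_⟩
    rw [hΦ]
    change (z - σ • b) + σ • b = z
    rw [sub_add_cancel]

end Steinberg

/-! ## §3 Over `Λ = ℤ₂⟦T⟧`: `ℓ(W) = 2·ℓ(Y)`, `ℓ(X) = ℓ(NX) + 2·ℓ(Y)`, and the counting lemma through `μ(Y)` -/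

section LambdaSteinberg

variable {Q : Type*} [Group Q] {M : Type*} [AddCommGroup M] [DistribMulAction Q M]
  {X : Type*} [AddCommGroup X] [_root_.Module (IwasawaAlgebra 2) X] [DistribMulAction Q X]
  [SMulCommClass Q (IwasawaAlgebra 2) X]

/-- **`ℓ_𝔭(W) = 2·ℓ_𝔭(Y)`** for `W = ker(1 + σ + σ²)`, `Y = W ⊓ X^τ`, at every prime of `Λ = ℤ₂⟦T⟧` (`W ≅ Y × Y`,
`lengthAt_prod`; `3 ∈ Λˣ`). At `𝔭 = (2)`: «`μ((1 − e₁)X) = 2·μ(Y)`». [cite: Washington1997, §13.2] -/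
theorem lengthAt_ker_norm_eq_two_mul {σ τ : Q} (hσ3 : ∀ x : X, σ • (σ • (σ • x)) = x)
    (hττ : ∀ x : X, τ • (τ • x) = x) (hτσ : ∀ x : X, τ • (σ • x) = σ • (σ • (τ • x)))
    (𝔭 : PrimeSpectrum (IwasawaAlgebra 2)) :
    lengthAt (IwasawaAlgebra 2)
        (LinearMap.ker (LinearMap.id + DistribSMul.toLinearMap (IwasawaAlgebra 2) X σ +
          (DistribSMul.toLinearMap (IwasawaAlgebra 2) X σ).comp (DistribSMul.toLinearMap (IwasawaAlgebra 2) X σ))) 𝔭 =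
      2 * lengthAt (IwasawaAlgebra 2)
        (↥(LinearMap.ker (LinearMap.id + DistribSMul.toLinearMap (IwasawaAlgebra 2) X σ +
            (DistribSMul.toLinearMap (IwasawaAlgebra 2) X σ).comp (DistribSMul.toLinearMap (IwasawaAlgebra 2) X σ)) ⊓
          LinearMap.ker (DistribSMul.toLinearMap (IwasawaAlgebra 2) X τ - LinearMap.id))) 𝔭 := by
  obtain ⟨e⟩ := nonempty_prod_fixed_linearEquiv_ker_norm (R := IwasawaAlgebra 2) (X := X)
    isUnit_three_iwasawaAlgebra_two hσ3 hττ hτσ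
  rw [← lengthAt_eq_of_linearEquiv e 𝔭, lengthAt_prod, two_mul]

/-- **`ℓ_𝔭(X) = ℓ_𝔭((1 + σ + σ²)X) + 2·ℓ_𝔭(Y)`** (parts XI + XII): the lead's structure remark «`μ₂(ℚ(W[2])) = μ(ℚ(√Δ_W)-part)
+ 2·μ(Y)`» at the level of an arbitrary `Λ = ℤ₂⟦T⟧`-module with `S₃`-relations. [cite: Washington1997, §13.2] -/
theorem lengthAt_eq_lengthAt_range_norm_add_two_mul {σ τ : Q} (hσ3 : ∀ x : X, σ • (σ • (σ • x)) = x)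
    (hττ : ∀ x : X, τ • (τ • x) = x) (hτσ : ∀ x : X, τ • (σ • x) = σ • (σ • (τ • x)))
    (𝔭 : PrimeSpectrum (IwasawaAlgebra 2)) :
    lengthAt (IwasawaAlgebra 2) X 𝔭 =
      lengthAt (IwasawaAlgebra 2)
          (LinearMap.range (LinearMap.id + DistribSMul.toLinearMap (IwasawaAlgebra 2) X σ +
            (DistribSMul.toLinearMap (IwasawaAlgebra 2) X σ).comp (DistribSMul.toLinearMap (IwasawaAlgebra 2) X σ))) 𝔭 +
        2 * lengthAt (IwasawaAlgebra 2)
          (↥(LinearMap.ker (LinearMap.id + DistribSMul.toLinearMap (IwasawaAlgebra 2) X σ +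
              (DistribSMul.toLinearMap (IwasawaAlgebra 2) X σ).comp (DistribSMul.toLinearMap (IwasawaAlgebra 2) X σ)) ⊓
            LinearMap.ker (DistribSMul.toLinearMap (IwasawaAlgebra 2) X τ - LinearMap.id))) 𝔭 := by
  rw [lengthAt_eq_lengthAt_range_norm_add (X := X) hσ3 𝔭, lengthAt_ker_norm_eq_two_mul hσ3 hττ hτσ 𝔭]

/-- **The counting lemma through the single invariant `μ(Y)`, `Q̄ = S₃` — NO norm-part input.** `Q` acts on the Klein
four-group `M` through `Aut(M) ≅ S₃` (`σ` fixed-point-free, `τ ≠ 1` fixing `m₀ ≠ 0`) and `Λ`-linearly on the finitely generated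
`Λ = ℤ₂⟦T⟧`-module `X`, the kernel acting trivially. Then `Hom_Q(X, V₄)` (`= Hom_Q(X/2X, V₄)`) is finite ⟺
`Y = ker(1 + σ + σ²) ⊓ X^τ` is `Λ`-torsion with `μ(Y) = 0` (part X + `ℓ(W) = 2ℓ(Y)`: `ℓ(W) = 0 ⟺ ℓ(Y) = 0`). The `e₁`-part and
Ferrero–Washington do not enter: the open content is `μ(Y)` alone. [cite: SerreGaloisCohomology1997, I §5.1] [cite: Washington1997, §13.2] -/
theorem finite_equivariant_iff_fixed_isTorsion_and_muInvariant_eq_zero_S3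
    [Module.Finite (IwasawaAlgebra 2) X] (h4 : Nat.card M = 4) (h2 : ∀ m : M, m + m = 0) {σ τ : Q}
    {m₀ : M} (hσ : ∀ m : M, σ • m = m → m = 0) (hm₀ : m₀ ≠ 0) (hτ0 : τ • m₀ = m₀)
    (hτ : ¬ ∀ m : M, τ • m = m) (hVN : ∀ g : Q, (∀ m : M, g • m = m) → ∀ x : X, g • x = x) :
    Finite {f : X →+ M // ∀ (g : Q) (x : X), f (g • x) = g • f x} ↔
      Module.IsTorsion (IwasawaAlgebra 2)
          (↥(LinearMap.ker (LinearMap.id + DistribSMul.toLinearMap (IwasawaAlgebra 2) X σ +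
              (DistribSMul.toLinearMap (IwasawaAlgebra 2) X σ).comp (DistribSMul.toLinearMap (IwasawaAlgebra 2) X σ)) ⊓
            LinearMap.ker (DistribSMul.toLinearMap (IwasawaAlgebra 2) X τ - LinearMap.id))) ∧
        muInvariant 2
          (↥(LinearMap.ker (LinearMap.id + DistribSMul.toLinearMap (IwasawaAlgebra 2) X σ +
              (DistribSMul.toLinearMap (IwasawaAlgebra 2) X σ).comp (DistribSMul.toLinearMap (IwasawaAlgebra 2) X σ)) ⊓
            LinearMap.ker (DistribSMul.toLinearMap (IwasawaAlgebra 2) X τ - LinearMap.id))) = 0 := by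
  have hσ3 : ∀ x : X, σ • (σ • (σ • x)) = x := smul_smul_smul_eq_self_of_kernel h4 h2 hσ hVN
  have hττ : ∀ x : X, τ • (τ • x) = x := tau_tau_V h4 h2 hσ hm₀ hτ0 hτ hVN
  have hτσ : ∀ x : X, τ • (σ • x) = σ • (σ • (τ • x)) := tau_sigma_V h4 h2 hσ hm₀ hτ0 hτ hVN
  haveI : IsNoetherian (IwasawaAlgebra 2) X := isNoetherian_of_isNoetherianRing_of_finite _ _
  rw [finite_equivariant_iff_sigmaEquivariant_S3 h4 h2 hσ hm₀ hτ0 hτ hVN,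
    finite_sigmaEquivariant_iff_lengthAt_eq_zero h4 h2 hσ hσ3, lengthAt_ker_norm_eq_two_mul hσ3 hττ hτσ,
    ← lengthAt_augIdealP_eq_zero_iff_isTorsion_and_muInvariant_eq_zero, mul_eq_zero]
  constructor
  · rintro (h | h)
    · exact absurd h two_ne_zero
    · exact h
  · exact fun h ↦ Or.inr h

end LambdaSteinberg

end Summit.BirchSwinnertonDyer.BirchSwinnertonDyer.Theorems.AlignedTransportAtTwoFineRoad.PerfectDescent

end
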